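import Summits.HubbardSuperconductivity.HubbardSuperconductivity.Theses.LiebTwin
import Literature.MathematicalPhysics.QuantumLattice.HubbardRingPerronFrobeniusProofs
import Summits.HubbardSuperconductivity.HubbardSuperconductivity.Theorems.LiebTwinTwinOnsiteCondensationStubPairCoherenceMajorant
import Summits.HubbardSuperconductivity.HubbardSuperconductivity.Theorems.LiebTwinTwinOnsiteCondensationStubSpinFlipMajorant

/-!
# Route `LiebTwin`, crux `TwinOnsiteCondensation` (stmt-HubbardSuperconductivity-15258), line `majorant`:
# K2 from some inter-species coherence (the line's composition, landed as a tree theorem)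

With both majorants proved (`…Theorems.LiebTwinMajorant.stub_pairCoherenceMajorant`, p170629, and
`…stub_spinFlipMajorant`, p170612), the composition of line `majorant` is an unconditional implication:
`twinOnsiteCondensation_of_someInterspeciesCoherence : C → TwinOnsiteCondensation`, where C
(`SomeInterspeciesCoherence`, the registered open stub `stub_someInterspeciesCoherence`, spelled out) says that at some box
point every normalised `(2n, 0)`-sector ground state of `hubbardTorus 2 L 1 U` carries macroscopic opposite-spin coherence in
SOME contraction kernel `G` — pairing `c·L⁴ ≤ Re⟨φ, O_Gᴴ O_G φ⟩` (`O_G = Σ G x y • c_{y↓} c_{x↑}`) or spin-flip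
`c·L⁴ ≤ Re⟨φ, O'_Gᴴ O'_G φ⟩` (`O'_G = Σ G x y • c†_{x↑} c_{y↓}`). Proof: square the floor and divide by the majorant
(`floor_of_sq_le'`): `F_s(φ̃) ≥ (c²/(κ₁+κ₂))·L⁴`. So K2 is FORCED by any-channel pairing or transverse spin-density-wave
order of the repulsive ground states; all that remains open in the line is C itself. [folklore bookkeeping over the two
landed majorants; sources as there: LiebPRL1989, Yang1962, Yang1989.] No definition and no named fact is introduced.
-/

-- the mandated namespace `Summit.<Summit>.<Problem>.Theorems` repeats `HubbardSuperconductivity`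
-- (single-problem summit, D-0017), which the `dupNamespace` linter flags on every declaration
set_option linter.dupNamespace false

noncomputable section

namespace Summit.HubbardSuperconductivity.HubbardSuperconductivity.Theorems.LiebTwinMajorant

open Matrix Finset Literature.MathematicalPhysics.QuantumLattice
open Summit.HubbardSuperconductivity.HubbardSuperconductivity.Theses.LiebTwin
open scoped ComplexOrder MatrixOrder Matrix.Norms.L2Operator

/-- Squaring a coherence floor against a majorant: from `c·X ≤ R`, `R² ≤ κ·X·F` (`c, κ, κ', X > 0`) conclude
`(c²/(κ+κ'))·X ≤ F`. [folklore] -/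
theorem floor_of_sq_le' {c κ κ' X R F : ℝ} (hc : 0 < c) (hκ : 0 < κ) (hκ' : 0 < κ') (hX : 0 < X)
    (hR : c * X ≤ R) (hmaj : R ^ 2 ≤ κ * X * F) : c ^ 2 / (κ + κ') * X ≤ F := by
  have hcX : 0 ≤ c * X := by positivity
  have h1 : (c * X) ^ 2 ≤ R ^ 2 := pow_le_pow_left₀ hcX hR 2
  have h2 : c ^ 2 * X * X ≤ κ * F * X := by nlinarith [h1, hmaj]
  have h3 : c ^ 2 * X ≤ κ * F := le_of_mul_le_mul_right h2 hX
  have h4 : c ^ 2 / (κ + κ') ≤ c ^ 2 / κ :=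
    div_le_div_of_nonneg_left (sq_nonneg c) hκ (by linarith)
  have h5 : c ^ 2 / (κ + κ') * X ≤ c ^ 2 / κ * X := mul_le_mul_of_nonneg_right h4 hX.le
  have h6 : c ^ 2 / κ * X ≤ F := by
    rw [div_mul_eq_mul_div, div_le_iff₀ hκ]
    linarith [h3]
  exact h5.trans h6

/-- **K2 from some inter-species coherence** (composition of line `majorant` with both majorants discharged):
if at some box point `(U, δ) ∈ (0,4] × [1/10,3/10]` every normalised `(2n,0)`-sector ground state of
`hubbardTorus 2 L 1 U` (even `L ≥ L₀`) has a contraction kernel `G` with `c·L⁴ ≤ Re⟨φ, O_Gᴴ O_G φ⟩` or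
`c·L⁴ ≤ Re⟨φ, O'_Gᴴ O'_G φ⟩`, then `TwinOnsiteCondensation` holds (with constant `c²/(κ₁+κ₂)` at the same point).
[folklore over `stub_pairCoherenceMajorant` / `stub_spinFlipMajorant`; LiebPRL1989, Yang1962] -/
theorem twinOnsiteCondensation_of_someInterspeciesCoherence :
    (∃ U ∈ Set.Ioc (0 : ℝ) 4, ∃ δ ∈ Set.Icc (1 / 10 : ℝ) (3 / 10), ∃ c : ℝ, 0 < c ∧ ∃ L₀ : ℕ,
      ∀ (L : ℕ) [NeZero L], L₀ ≤ L → Even L →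
        ∀ φ : Fock (Orb (FermionTorus 2 L)), star φ ⬝ᵥ φ = 1 →
          IsGroundStateInSector (hubbardTorus 2 L 1 U) (2 * ⌊(1 - δ) * (L : ℝ) ^ 2 / 2⌋₊) 0 φ →
          ∃ G : Matrix (FermionTorus 2 L) (FermionTorus 2 L) ℂ,
            (∀ v : FermionTorus 2 L → ℂ, (star (G *ᵥ v) ⬝ᵥ (G *ᵥ v)).re ≤ (star v ⬝ᵥ v).re) ∧
            (c * (L : ℝ) ^ 4 ≤
                (expect ((∑ x : FermionTorus 2 L, ∑ y : FermionTorus 2 L,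
                      G x y • (annihilation (orb y 1) * annihilation (orb x 0)))ᴴ *
                    (∑ x : FermionTorus 2 L, ∑ y : FermionTorus 2 L,
                      G x y • (annihilation (orb y 1) * annihilation (orb x 0)))) φ).re ∨
              c * (L : ℝ) ^ 4 ≤
                (expect ((∑ x : FermionTorus 2 L, ∑ y : FermionTorus 2 L,
                      G x y • (creation (orb x 0) * annihilation (orb y 1)))ᴴ *
                    (∑ x : FermionTorus 2 L, ∑ y : FermionTorus 2 L,
                      G x y • (creation (orb x 0) * annihilation (orb y 1)))) φ).re)) →
      TwinOnsiteCondensation := by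
  rintro ⟨U, hU, δ, hδ, c, hc, L₀, hcoh⟩
  obtain ⟨κ₁, hκ₁, h1⟩ := stub_pairCoherenceMajorant
  obtain ⟨κ₂, hκ₂, h2⟩ := stub_spinFlipMajorant
  refine ⟨U, hU, δ, hδ, c ^ 2 / (κ₁ + κ₂), by positivity, L₀, ?_⟩
  intro L _ hL hE φ hφ hgs
  have hsec : IsInSector (⌊(1 - δ) * (L : ℝ) ^ 2 / 2⌋₊) (⌊(1 - δ) * (L : ℝ) ^ 2 / 2⌋₊) φ :=
    (mem_szSector_two_mul_zero_iff _ φ).1 hgs.1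
  have hLpos : (0 : ℝ) < (L : ℝ) := Nat.cast_pos.2 (Nat.pos_of_ne_zero (NeZero.ne L))
  have hL4 : (0 : ℝ) < (L : ℝ) ^ 4 := pow_pos hLpos 4
  obtain ⟨G, hG, hpair | hflip⟩ := hcoh L hL hE φ hφ hgs
  · have hmaj := h1 L _ φ hφ hsec G hG
    have key := floor_of_sq_le' hc hκ₁ hκ₂ hL4 hpair hmaj
    simpa using key
  · have hmaj := h2 L _ φ hφ hsec G hG
    have key := floor_of_sq_le' hc hκ₂ hκ₁ hL4 hflip hmaj
    rw [add_comm] at key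
    simpa using key

end Summit.HubbardSuperconductivity.HubbardSuperconductivity.Theorems.LiebTwinMajorant

end
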